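/-
Copyright: lit-balaban cell, Phase-2 proof seat p33 (gen 13).  Statement-level skeleton of a published paper; no proof claims beyond
what the kernel checks below.
-/
import Literature.MathematicalPhysics.QuantumFieldTheory.BalabanImbrieJaffe1984to88.BIJ85Eq454Holonomy

/-!
# `BalabanImbrieJaffe1984to88.BIJ85FluxSectors731` — [BalabanImbrieJaffe1985] Sect. 7.3 p. 326: the small-field condition **(7.3.1)**
# `|v(∂p) − 1| ≤ e_k𝓅(e_k)` on the unit torus ADMITS NONZERO-FLUX SECTORS, the pull-back `Q^{s*}_kv` of (4.5.3) and the actual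
# background `u_k` of **(4.5.4)** carry the flux of `v`, and a nonzero-flux `u_k` admits NO gauge on the whole η-torus in which
# `u_k = exp(iκA)` with all circulations `|κ(∂A)(p)| < π` — the C1-carrier companion (BIJ85's own tori `Balaban1983to89.Setup`, fields
# `BIJ85Sect1Model.U1Field`, block geometry `BIJ85Eq224Proof*.torusBlockBondsIter/torusEdgeCellsIter`) of this seat's B4-carrier scope
# witness `BIJ85GlobalGaugeObstruction326`; row C1.Eq7.3.1-7.3.2, GAPS G-C1-05 ADDENDUM 13

statement-level skeleton of published theorems with citation tags; proofs where landed; nothing here is a claim about the Yang–Mills mass gap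

PDF held: `paper:balaban1985-cmp97-bij-higgs-minimizers` (journal page = PDF page + 298), p. 326 [PDF 28], p. 318 [PDF 20], p. 312–313 [PDF 14–15],
p. 305 [PDF 7], p. 303 [PDF 5]; text layer re-read this session.

CITATION HEADER (lean-in-tree rule).  Phase-2 file of the lit-balaban TYPED SKELETON (HOME `run/shared/lean/pub/lit-balaban/`), seat p33 gen 13
(unit `lit-balaban-p33-g13`; TAKING line HOME/STATUS.md 2026-08-22T10:19Z, second file of the generation); SKELETON row **C1.Eq7.3.1-7.3.2**
(owner r15, referee ref-5).  KIND: scope witness (ours, disclosed as such) — which configurations the printed hypothesis (7.3.1) admits and what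
the printed constructions (4.5.3)/(4.5.4) make of them; every declaration carries the citation tag of the display it concerns.  Objects BY NAME:
r15's `BIJ85Sect1Model.plaq`/`U1Field`/`argB`/`gaugeU`/`plaq_gauge`/`bondPotential`, `BIJ85SmallFieldSplit64.expField`/`curl1`/`translate62`/
`argB_mul_of_small`/`argB_exp_mul_I`, p31's `BIJ85Eq454Holonomy.plaq_QsstarU1_of_mem`/`_of_not_mem`/`expField_background_eq_translate62`/
`argB_one`, `BIJ85Eq224ProofPart2.torusEdgeCellsIter`/`mem_edgeBIter_iff`, `BIJ85Eq224Proof.torusBlockBondsIter`,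
`Balaban1983to89.B7SectAStatements.blockOfIter`, `Balaban1983to89.Site.val_blockOf`; nothing restated.
THE PRINTED TEXT, verbatim.  p. 326: *"In particular, let us assume that for the unit lattice field v, |v(∂p) − 1| ≤ e_k𝓅(e_k), (7.3.1) where
𝓅(e_k) = (1 + ln e_k^{−1})^𝓅. … In order to remain within the framework of this reference, we remark that by change of gauge u_k can be
transformed in a local region Λ into a configuration of the form exp[ie_kηA], where A is smooth and small."*; p. 312: *"(Q^{s*}_kv)_b = v_{b′}
if b ∈ B^s_k(b′), 1 otherwise (4.5.3)"* (typed by p31/r15 as `plaq_QsstarU1_of_mem/_of_not_mem`: `(Q^{s*}_kv)(∂p) = v(∂p′)` on the edge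
plaquettes `p ∈ B^e_k(p′)`, `1` elsewhere); p. 313: *"(u_k)_b = (Q^{s*}_kv)_b exp[−ie_kη(𝒟_k∂^*Q^{e*}_kf^{(k)})_b]. (4.5.4)"*; p. 318: *"on the
unit lattice let u = u′Q^{s*}v, u′ = exp(ie_kB′). (6.2)"*; p. 303: *"u_b → h(b₋)h(b₊)^{−1}u_b = u^h_b. (2.7)"*.

THE POINT OF THIS FILE.  (7.3.1) constrains the plaquette variables of `v` only.  On the tori of record (`Site P j = (ℤ/N_j)^d`,
`N_j = 2L^{m+K−j}`) a `U(1)` field has an INTEGER FLUX through every coordinate 2-torus — `(2π)⁻¹ ×` the sum of the principal plaquette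
angles `argB u(∂p) ∈ [−π, π)` (branch (2.11)) over the `N_j²` plaquettes of the section (§1–§2; the product of the plaquette variables over a
closed section is `1`) — which is gauge invariant (§6), does not change when the field is multiplied bondwise by an exact factor `exp(icB′)`
with small circulations (§3: the shape of (6.2), and of the second factor of (4.5.4)), and IS INHERITED BY THE PULL-BACK: along a fine
`(μ, ν)`-section of the η-torus `T^{(i)}` the plaquette variables of `Q^{s*}_kv` are `v(∂p′)` at the `N_{i+k}²` corner plaquettes (both labels
`≡ L^k − 1 (mod L^k)`, one per unit plaquette `p′` of the unit section through the block point) and `1` elsewhere, so `flux(Q^{s*}_kv) =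
flux(v)` EXACTLY (§5), and `flux(u_k) = flux(v)` for the actual background (4.5.4) as soon as the plaquette angles of `v` and the
circulations `e_kη(∂X)(p)` are `< π/2` (§5).  The SEAM FIELD (§4) has `|v(∂p) − 1| ≤ 2π/N²` at EVERY plaquette — (7.3.1) as soon as
`N² ≥ 2π/(e_k𝓅(e_k))` — and flux `1`; its background `u_k` therefore has flux `1` through every fine coordinate 2-torus in the seam plane, and
(§6) a field of nonzero flux is in NO gauge of the form `exp(iκA)` with all `|κ(∂A)(p)| < π` along the section (such a field has flux `0` by
Stokes).  Hence (`exists_background454_no_global_small_gauge`) the p. 326 sentence cannot hold with «a local region Λ» replaced by the whole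
torus: this is the kernel content of HOME/GAPS.md G-C1-05 ADDENDUM 13 on BIJ85's own carriers (the B4-carrier form — (1.7)-regularity on
`Ω₀ = T_η` forces flux `0` in r01's `torusPairFam` — is `BIJ85GlobalGaugeObstruction326`; the identification of the two tori is a reading).

WHAT IS PROVED (0 `sorry`, standard axioms; theorems + five definitions with bodies `secSite`, `angSum`, `fluxU`, `seamU1`, `planeSite`; no
`Prop`-valued definition, no named fact).
* §1 `secSite`/`secSite_shift_*`, **`prod_plaq_section`** (multiplicative Stokes: the product of the plaquette variables of ANY `U(1)` field
  over a coordinate 2-section is `1`), `sum_curl1_section` (additive Stokes for `∂B′`).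
* §2 `angSum`, `cexp_angSum` (`e^{i·angSum} = 1`), **`fluxU`** ∈ ℤ with **`angSum_eq_two_pi_mul_fluxU`**, `fluxU_eq_of_angSum_eq`.
* §3 **`fluxU_translate62_expField`** — `flux(exp(icB′)·u) = flux(u)` whenever `|argB u(∂p)| < π/2` and `|c(∂B′)(p)| < π/2` on the section.
* §4 `seamU1`, `seamU1_apply_*`, `plaq_seamU1_plane`/`plaq_seamU1_of_ne` (plaquette variables `e^{2πi/N²}` in the plane, `1` elsewhere),
  **`norm_plaq_seamU1_sub_one_le`** (`|v(∂p) − 1| ≤ 2π/N²` everywhere), **`fluxU_seamU1`** (`= 1`), **`exists_hyp731Shape_flux_one`**.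
* §5 `planeSite`, `angSum_eq_sum_planeSite`, `sitesPerDir_eq_mul_pow` (`N_i = N_{i+k}L^k`), `val_blockOfIter`, **`blockOfIter_shift_iff`**
  (the k-fold edge condition of `torusEdgeCellsIter` in labels: `x_μ ≡ L^k − 1 (mod L^k)`, wrap-around included), **`sum_edge_eq`** (one edge
  label per block: a bijection `{a ≡ −1 (L^k)} ≃ ℤ/N_{i+k}`), `blockOfIter_planeSite`, **`plaq_QsstarU1_planeSite`**, **`angSum_QsstarU1`**,
  **`fluxU_QsstarU1`** (`flux(Q^{s*}_kv) = flux(v)`, exact), **`fluxU_background454`** (`flux(u_k) = flux(v)` under the two smallnesses),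
  `three_le_sitesPerDir`, `abs_argB_plaq_seamU1_le`, **`exists_flux_one_background454`**.
* §6 `fluxU_congr_plaq`, **`fluxU_gaugeU`** (gauge invariance, (2.7)), **`fluxU_expField_eq_zero`** (`exp(iκA)` with all `|κ(∂A)(p)| < π`
  along the section has flux `0`), **`exists_large_circ_of_flux_ne_zero`**, **`exists_background454_no_global_small_gauge`** (headline).
HONEST SCOPE.  Abelian bookkeeping on the tori of record, standing range `i + k ≤ m + K`, `2 ≤ d`, `ηL^k = 1`, `e ≠ 0` where a logarithm is
divided by `e`, `N_{i+k} ≥ 3` (every level below the top) for the `< π/2` margin of the seam field; (7.3.1) in its printed shape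
`|v(∂p) − 1| ≤ ε` (r15's `ScalarStabData.plaqDev`); `X` is a parameter with the smallness `|e_kη(∂X)(p)| < π/2` ASSUMED (the paper's `X =
𝒟_k∂^*Q^{e*}_kf^{(k)}` and its bound (4.2.6) are not touched); nothing about propagators is proved here, and the stability estimate (7.3.2)
itself is untouched here.  Unit `lit-balaban-p33` (literature-prover-lit-balaban-p33-g13-0), 2026-08-22.  NOT summit progress.
-/

open scoped BigOperators
open Finset

namespace Literature.MathematicalPhysics.QuantumFieldTheory.BalabanImbrieJaffe1984to88.BIJ85FluxSectors731

open Literature.MathematicalPhysics.QuantumFieldTheory.Balaban1983to89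
open BIJ85Sect1Model (U1Field plaq argB argB_mem_Ico exp_argB)
open BIJ85Sect1Model (bondPotential exp_bondPotential gaugeU plaq_gauge)
open BIJ85SmallFieldSplit64 (plaqField expField curl1 translate62 plaq_translate62 plaq_expField argB_mul_of_small argB_exp_mul_I argB_eq_arg)
open BIJ85Eq224Proof (torusBlockBondsIter)
open BIJ85Eq224ProofPart2 (torusEdgeCellsIter mem_edgeBIter_iff)
open BIJ85Eq454Holonomy (plaq_QsstarU1_of_mem plaq_QsstarU1_of_not_mem argB_one expField_background_eq_translate62)
open Balaban1983to89.B7SectAStatements (blockOfIter blockOfIter_succ blockOfIter_zero)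
open Complex (exp I)

noncomputable section

variable {P : Params} {j : ℕ}

/-! ## §1  Coordinate 2-sections of the torus `T^{(j)}` and Stokes -/

/-- the site `x + s·e_μ + t·e_ν` of the `(μ, ν)`-coordinate 2-torus through `x` (`s, t ∈ ℤ/N_j`). [cite: BalabanImbrieJaffe1985, (7.3.1) p.326] -/
def secSite (x : Balaban1983to89.Site P j) (μ ν : Fin P.d) (s t : ZMod (P.sitesPerDir j)) : Balaban1983to89.Site P j :=
  fun ρ => if ρ = μ then x μ + s else if ρ = ν then x ν + t else x ρ

/-- stepping in direction `μ` along the section. [cite: BalabanImbrieJaffe1985, (7.3.1) p.326] -/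
theorem secSite_shift_fst {x : Balaban1983to89.Site P j} {μ ν : Fin P.d} (hμν : μ ≠ ν) (s t : ZMod (P.sitesPerDir j)) :
    (secSite x μ ν s t).shift μ = secSite x μ ν (s + 1) t := by
  funext ρ
  simp only [Balaban1983to89.Site.shift, secSite, Function.update_apply]
  by_cases h : ρ = μ
  · subst h; simp [add_assoc]
  · simp [h]

/-- stepping in direction `ν` along the section. [cite: BalabanImbrieJaffe1985, (7.3.1) p.326] -/
theorem secSite_shift_snd {x : Balaban1983to89.Site P j} {μ ν : Fin P.d} (hμν : μ ≠ ν) (s t : ZMod (P.sitesPerDir j)) :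
    (secSite x μ ν s t).shift ν = secSite x μ ν s (t + 1) := by
  funext ρ
  simp only [Balaban1983to89.Site.shift, secSite, Function.update_apply]
  by_cases h : ρ = ν
  · subst h; simp [hμν.symm, add_assoc]
  · simp [h]

/-- **MULTIPLICATIVE STOKES**: the product of the plaquette variables of ANY `U(1)` field over the `N_j²` plaquettes of a coordinate
2-torus is `1` (every bond of the closed surface enters twice, with opposite orientations; `U(1)` is abelian).
[cite: BalabanImbrieJaffe1985, (1.1) p.300, (7.3.1) p.326] -/
theorem prod_plaq_section (u : U1Field P j) (x : Balaban1983to89.Site P j) {μ ν : Fin P.d} (h : μ < ν) :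
    ∏ s : ZMod (P.sitesPerDir j), ∏ t : ZMod (P.sitesPerDir j), plaq u ⟨secSite x μ ν s t, μ, ν, h⟩ = 1 := by
  have hμν : μ ≠ ν := ne_of_lt h
  set a : ZMod (P.sitesPerDir j) → ZMod (P.sitesPerDir j) → Circle := fun s t => u ⟨secSite x μ ν s t, μ⟩ with ha
  set b : ZMod (P.sitesPerDir j) → ZMod (P.sitesPerDir j) → Circle := fun s t => u ⟨secSite x μ ν s t, ν⟩ with hb
  have hplaq : ∀ s t, plaq u ⟨secSite x μ ν s t, μ, ν, h⟩ = a s t * b (s + 1) t * (a s (t + 1))⁻¹ * (b s t)⁻¹ := by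
    intro s t
    simp only [plaq, ha, hb, secSite_shift_fst hμν, secSite_shift_snd hμν]
  simp_rw [hplaq]
  -- the two telescoping families
  have hA : ∏ s : ZMod (P.sitesPerDir j), ∏ t : ZMod (P.sitesPerDir j), (a s t * (a s (t + 1))⁻¹) = 1 := by
    refine Finset.prod_eq_one fun s _ => ?_
    rw [Finset.prod_mul_distrib, Finset.prod_inv_distrib]
    have : ∏ t : ZMod (P.sitesPerDir j), a s (t + 1) = ∏ t : ZMod (P.sitesPerDir j), a s t :=
      Fintype.prod_equiv (Equiv.addRight 1) _ _ (fun t => rfl)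
    rw [this, mul_inv_cancel]
  have hB : ∏ s : ZMod (P.sitesPerDir j), ∏ t : ZMod (P.sitesPerDir j), (b (s + 1) t * (b s t)⁻¹) = 1 := by
    rw [Finset.prod_comm]
    refine Finset.prod_eq_one fun t _ => ?_
    rw [Finset.prod_mul_distrib, Finset.prod_inv_distrib]
    have : ∏ s : ZMod (P.sitesPerDir j), b (s + 1) t = ∏ s : ZMod (P.sitesPerDir j), b s t :=
      Fintype.prod_equiv (Equiv.addRight 1) _ _ (fun s => rfl)
    rw [this, mul_inv_cancel]
  have hsplit : ∀ s t, a s t * b (s + 1) t * (a s (t + 1))⁻¹ * (b s t)⁻¹ = (a s t * (a s (t + 1))⁻¹) * (b (s + 1) t * (b s t)⁻¹) := by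
    intro s t; simp only [mul_comm, mul_left_comm, mul_assoc]
  simp_rw [hsplit, Finset.prod_mul_distrib]
  simp_rw [Finset.prod_mul_distrib] at hA hB
  rw [hA, hB, mul_one]

/-- **ADDITIVE STOKES**: the circulations `(∂B′)(p)` of ANY real bond field over the plaquettes of a coordinate 2-torus sum to `0`.
[cite: BalabanImbrieJaffe1985, (6.4) p.318] -/
theorem sum_curl1_section (B : PBond P j → ℝ) (x : Balaban1983to89.Site P j) {μ ν : Fin P.d} (h : μ < ν) :
    ∑ s : ZMod (P.sitesPerDir j), ∑ t : ZMod (P.sitesPerDir j), curl1 B ⟨secSite x μ ν s t, μ, ν, h⟩ = 0 := by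
  have hμν : μ ≠ ν := ne_of_lt h
  set a : ZMod (P.sitesPerDir j) → ZMod (P.sitesPerDir j) → ℝ := fun s t => B ⟨secSite x μ ν s t, μ⟩ with ha
  set b : ZMod (P.sitesPerDir j) → ZMod (P.sitesPerDir j) → ℝ := fun s t => B ⟨secSite x μ ν s t, ν⟩ with hb
  have hcurl : ∀ s t, curl1 B ⟨secSite x μ ν s t, μ, ν, h⟩ = (a s t - a s (t + 1)) + (b (s + 1) t - b s t) := by
    intro s t
    simp only [curl1, ha, hb, secSite_shift_fst hμν, secSite_shift_snd hμν]
    ring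
  simp_rw [hcurl, Finset.sum_add_distrib]
  have hA : ∑ s : ZMod (P.sitesPerDir j), ∑ t : ZMod (P.sitesPerDir j), (a s t - a s (t + 1)) = 0 := by
    refine Finset.sum_eq_zero fun s _ => ?_
    rw [Finset.sum_sub_distrib]
    have : ∑ t : ZMod (P.sitesPerDir j), a s (t + 1) = ∑ t : ZMod (P.sitesPerDir j), a s t :=
      Fintype.sum_equiv (Equiv.addRight 1) _ _ (fun t => rfl)
    rw [this, sub_self]
  have hB : ∑ s : ZMod (P.sitesPerDir j), ∑ t : ZMod (P.sitesPerDir j), (b (s + 1) t - b s t) = 0 := by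
    rw [Finset.sum_comm]
    refine Finset.sum_eq_zero fun t _ => ?_
    rw [Finset.sum_sub_distrib]
    have : ∑ s : ZMod (P.sitesPerDir j), b (s + 1) t = ∑ s : ZMod (P.sitesPerDir j), b s t :=
      Fintype.sum_equiv (Equiv.addRight 1) _ _ (fun s => rfl)
    rw [this, sub_self]
  rw [hA, hB, add_zero]

/-! ## §2  The integer flux of a `U(1)` field through a coordinate 2-torus -/

/-- the sum of the PRINCIPAL plaquette angles `argB u(∂p) ∈ [−π, π)` (branch (2.11)) over the `(μ, ν)`-section through `x`.
[cite: BalabanImbrieJaffe1985, (2.11) p.303, (7.3.1) p.326] -/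
def angSum (u : U1Field P j) (x : Balaban1983to89.Site P j) (μ ν : Fin P.d) (h : μ < ν) : ℝ :=
  ∑ s : ZMod (P.sitesPerDir j), ∑ t : ZMod (P.sitesPerDir j), argB ((plaq u ⟨secSite x μ ν s t, μ, ν, h⟩ : Circle) : ℂ)

/-- `e^{i·angSum} = Π_p u(∂p) = 1`. [cite: BalabanImbrieJaffe1985, (2.11) p.303, (7.3.1) p.326] -/
theorem cexp_angSum (u : U1Field P j) (x : Balaban1983to89.Site P j) {μ ν : Fin P.d} (h : μ < ν) :
    exp ((angSum u x μ ν h : ℝ) * I) = 1 := by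
  unfold angSum
  push_cast
  rw [Finset.sum_mul, Complex.exp_sum]
  simp_rw [Finset.sum_mul, Complex.exp_sum, exp_argB]
  have h2 := congrArg (⇑Circle.coeHom) (prod_plaq_section u x h)
  simp only [map_prod, map_one, Circle.coeHom_apply] at h2
  exact h2

/-- hence the angle sum is an integer multiple of `2π`. [cite: BalabanImbrieJaffe1985, (7.3.1) p.326] -/
theorem exists_angSum_eq (u : U1Field P j) (x : Balaban1983to89.Site P j) {μ ν : Fin P.d} (h : μ < ν) :
    ∃ m : ℤ, angSum u x μ ν h = 2 * Real.pi * m := by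
  obtain ⟨n, hn⟩ := Complex.exp_eq_one_iff.1 (cexp_angSum u x h)
  refine ⟨n, ?_⟩
  have h1 : ((angSum u x μ ν h : ℝ) : ℂ) * I = ((2 * Real.pi * n : ℝ) : ℂ) * I := by
    rw [hn]; push_cast; ring
  have h2 := mul_right_cancel₀ Complex.I_ne_zero h1
  exact_mod_cast h2

/-- **THE FLUX** of a `U(1)` field through the `(μ, ν)`-coordinate 2-torus through `x`: the integer `angSum/(2π)`.
[cite: BalabanImbrieJaffe1985, (7.3.1) p.326] -/
def fluxU (u : U1Field P j) (x : Balaban1983to89.Site P j) (μ ν : Fin P.d) (h : μ < ν) : ℤ := round (angSum u x μ ν h / (2 * Real.pi))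

/-- `angSum = 2π·flux`. [cite: BalabanImbrieJaffe1985, (7.3.1) p.326] -/
theorem angSum_eq_two_pi_mul_fluxU (u : U1Field P j) (x : Balaban1983to89.Site P j) {μ ν : Fin P.d} (h : μ < ν) :
    angSum u x μ ν h = 2 * Real.pi * fluxU u x μ ν h := by
  obtain ⟨m, hm⟩ := exists_angSum_eq u x h
  have hq : angSum u x μ ν h / (2 * Real.pi) = m := by
    rw [hm]; field_simp
  unfold fluxU
  rw [hq, round_intCast, hm]

/-- reading the flux off any exact evaluation of the angle sum. [cite: BalabanImbrieJaffe1985, (7.3.1) p.326] -/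
theorem fluxU_eq_of_angSum_eq (u : U1Field P j) (x : Balaban1983to89.Site P j) {μ ν : Fin P.d} (h : μ < ν) {m : ℤ}
    (hm : angSum u x μ ν h = 2 * Real.pi * m) : fluxU u x μ ν h = m := by
  have h1 := angSum_eq_two_pi_mul_fluxU u x h
  rw [hm] at h1
  have h2 : (m : ℝ) = fluxU u x μ ν h := mul_left_cancel₀ (by positivity) h1
  exact_mod_cast h2.symm

/-! ## §3  Multiplying by a small exact factor does not change the flux -/

/-- **THE EXACT FACTOR OF (6.2)/(4.5.4) DOES NOT CHANGE THE FLUX**: for `u′ = exp(icB′)·u` bondwise (`translate62 (expField c B′) u`), if on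
the section the principal angles of `u` and the circulations of `cB′` are both `< π/2` in absolute value, then the principal angles ADD
(`argB_mul_of_small`), the circulations sum to `0` (Stokes), and `flux(u′) = flux(u)`.  With `c = −e_kη`, `B′ = X = 𝒟_k∂^*Q^{e*}_kf^{(k)}` and
`u = Q^{s*}_kv` this is the passage from the pull-back to the actual background (4.5.4). [cite: BalabanImbrieJaffe1985, (6.2) p.318, (4.5.4) p.313] -/
theorem fluxU_translate62_expField (u : U1Field P j) (c : ℝ) (B : PBond P j → ℝ) (x : Balaban1983to89.Site P j) {μ ν : Fin P.d} (h : μ < ν)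
    (hu : ∀ s t, |argB ((plaq u ⟨secSite x μ ν s t, μ, ν, h⟩ : Circle) : ℂ)| < Real.pi / 2)
    (hB : ∀ s t, |c * curl1 B ⟨secSite x μ ν s t, μ, ν, h⟩| < Real.pi / 2) :
    fluxU (translate62 (expField c B) u) x μ ν h = fluxU u x μ ν h := by
  apply fluxU_eq_of_angSum_eq
  rw [← angSum_eq_two_pi_mul_fluxU u x h]
  unfold angSum
  have hterm : ∀ s t, argB ((plaq (translate62 (expField c B) u) ⟨secSite x μ ν s t, μ, ν, h⟩ : Circle) : ℂ)
      = c * curl1 B ⟨secSite x μ ν s t, μ, ν, h⟩ + argB ((plaq u ⟨secSite x μ ν s t, μ, ν, h⟩ : Circle) : ℂ) := by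
    intro s t
    rw [plaq_translate62, plaq_expField, Circle.coe_mul, Circle.coe_exp]
    have hB' := hB s t
    have hu' := hu s t
    have hargE : Complex.arg (exp ((c * curl1 B ⟨secSite x μ ν s t, μ, ν, h⟩ : ℝ) * I)) = c * curl1 B ⟨secSite x μ ν s t, μ, ν, h⟩ := by
      rw [Complex.arg_exp_mul_I, toIocMod_eq_self]
      constructor <;> linarith [abs_lt.1 hB', Real.pi_pos]
    have hargBz : argB (exp ((c * curl1 B ⟨secSite x μ ν s t, μ, ν, h⟩ : ℝ) * I)) = c * curl1 B ⟨secSite x μ ν s t, μ, ν, h⟩ :=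
      argB_exp_mul_I ⟨by linarith [abs_lt.1 hB', Real.pi_pos], by linarith [abs_lt.1 hB', Real.pi_pos]⟩
    have hne : Complex.arg ((plaq u ⟨secSite x μ ν s t, μ, ν, h⟩ : Circle) : ℂ) ≠ Real.pi := by
      intro hπ
      have := hu'
      rw [show argB ((plaq u ⟨secSite x μ ν s t, μ, ν, h⟩ : Circle) : ℂ) = -Real.pi by simp [argB, hπ]] at this
      rw [abs_neg, abs_of_pos Real.pi_pos] at this
      linarith [Real.pi_pos]
    have hargu : |Complex.arg ((plaq u ⟨secSite x μ ν s t, μ, ν, h⟩ : Circle) : ℂ)| < Real.pi / 2 := by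
      rw [← argB_eq_arg hne]; exact hu'
    rw [show (↑(c * curl1 B ⟨secSite x μ ν s t, μ, ν, h⟩) : ℂ) * I = ((c * curl1 B ⟨secSite x μ ν s t, μ, ν, h⟩ : ℝ) : ℂ) * I by rfl]
    rw [argB_mul_of_small (Complex.exp_ne_zero _) (Circle.coe_ne_zero _) (by rw [hargE]; exact hB') hargu, hargBz]
  simp_rw [hterm, Finset.sum_add_distrib, ← Finset.mul_sum]
  rw [sum_curl1_section B x h, mul_zero, zero_add]

/-! ## §4  The seam field: `|v(∂p) − 1| ≤ 2π/N²` everywhere, flux `1` -/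

section Seam

variable (P j)

/-- the side `N_j = 2L^{m+K−j}` of `T^{(j)}` is at least `2`. [cite: BalabanImbrieJaffe1985, (7.3.1) p.326] -/
theorem two_le_sitesPerDir : 2 ≤ P.sitesPerDir j := by
  unfold Params.sitesPerDir
  have : 1 ≤ P.L ^ (P.m + P.K - j) := Nat.one_le_pow _ _ P.L_pos
  omega

variable {P j}
variable (μ₀ ν₀ : Fin P.d)

/-- **THE SEAM FIELD** on `T^{(j)}` in the plane `(μ₀, ν₀)`: `v_{⟨x, x+e_{ν₀}⟩} = e^{2πi x_{μ₀}/N²}` (the linear potential of the constant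
field strength `2π/N²`), closed up on the last `μ₀`-slice by the seam `v_{⟨x, x+e_{μ₀}⟩} = e^{−2πi x_{ν₀}/N}` (`x_{μ₀} = N − 1`); all other
bond variables `1` (`x_ρ ∈ {0, …, N−1}` the standard representatives). [cite: BalabanImbrieJaffe1985, (7.3.1) p.326] -/
def seamU1 : U1Field P j := fun b =>
  if b.dir = ν₀ then Circle.exp (2 * Real.pi * ((b.src μ₀).val : ℝ) / ((P.sitesPerDir j : ℝ) ^ 2))
  else if b.dir = μ₀ ∧ (b.src μ₀).val = P.sitesPerDir j - 1 then Circle.exp (-(2 * Real.pi * ((b.src ν₀).val : ℝ) / (P.sitesPerDir j : ℝ)))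
  else 1

variable {μ₀ ν₀}

/-- the value of a shifted coordinate: `(x + e_μ)_μ = x_μ + 1`, or `0` on the last slice. [folklore] -/
private theorem val_shift_self (x : Balaban1983to89.Site P j) (μ : Fin P.d) :
    ((x μ).val < P.sitesPerDir j - 1 ∧ (x.shift μ μ).val = (x μ).val + 1)
    ∨ ((x μ).val = P.sitesPerDir j - 1 ∧ (x.shift μ μ).val = 0) := by
  have hN := two_le_sitesPerDir P j
  haveI : Fact (1 < P.sitesPerDir j) := ⟨by omega⟩
  have hs : x.shift μ μ = x μ + 1 := by simp [Balaban1983to89.Site.shift]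
  have hlt := ZMod.val_lt (x μ)
  rw [hs, ZMod.val_add, ZMod.val_one]
  by_cases h : (x μ).val = P.sitesPerDir j - 1
  · right
    refine ⟨h, ?_⟩
    rw [h, Nat.sub_add_cancel (by omega), Nat.mod_self]
  · left
    exact ⟨by omega, Nat.mod_eq_of_lt (by omega)⟩

/-- a shift in another direction does not move a coordinate. [folklore] -/
private theorem shift_apply_ne (x : Balaban1983to89.Site P j) {μ ρ : Fin P.d} (h : ρ ≠ μ) : x.shift μ ρ = x ρ := by
  simp [Balaban1983to89.Site.shift, h]

/-- the `ν₀`-bond variables of the seam field. [cite: BalabanImbrieJaffe1985, (7.3.1) p.326] -/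
theorem seamU1_apply_snd (y : Balaban1983to89.Site P j) :
    seamU1 μ₀ ν₀ ⟨y, ν₀⟩ = Circle.exp (2 * Real.pi * ((y μ₀).val : ℝ) / ((P.sitesPerDir j : ℝ) ^ 2)) := by
  simp [seamU1]

/-- the `μ₀`-bond variables of the seam field. [cite: BalabanImbrieJaffe1985, (7.3.1) p.326] -/
theorem seamU1_apply_fst (hne : μ₀ ≠ ν₀) (y : Balaban1983to89.Site P j) :
    seamU1 μ₀ ν₀ ⟨y, μ₀⟩ = if (y μ₀).val = P.sitesPerDir j - 1
      then Circle.exp (-(2 * Real.pi * ((y ν₀).val : ℝ) / (P.sitesPerDir j : ℝ))) else 1 := by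
  simp [seamU1, hne]

/-- the bond variables of the seam field outside its plane are `1`. [cite: BalabanImbrieJaffe1985, (7.3.1) p.326] -/
theorem seamU1_apply_of_ne {ρ : Fin P.d} (h0 : ρ ≠ μ₀) (h1 : ρ ≠ ν₀) (y : Balaban1983to89.Site P j) : seamU1 μ₀ ν₀ ⟨y, ρ⟩ = 1 := by
  simp [seamU1, h0, h1]

/-- **THE PLAQUETTE VARIABLES OF THE SEAM FIELD IN ITS PLANE ARE ALL `e^{2πi/N²}`** (at the seam corner the exponent differs by a full turn).
[cite: BalabanImbrieJaffe1985, (7.3.1) p.326] -/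
theorem plaq_seamU1_plane (hμν : μ₀ < ν₀) (x : Balaban1983to89.Site P j) :
    plaq (seamU1 μ₀ ν₀) ⟨x, μ₀, ν₀, hμν⟩ = Circle.exp (2 * Real.pi / ((P.sitesPerDir j : ℝ) ^ 2)) := by
  have hne : μ₀ ≠ ν₀ := ne_of_lt hμν
  have hN2 : 2 ≤ P.sitesPerDir j := two_le_sitesPerDir P j
  have hNR : (2 : ℝ) ≤ P.sitesPerDir j := by exact_mod_cast hN2
  have hN0 : (P.sitesPerDir j : ℝ) ≠ 0 := by positivity
  have hsub : ((P.sitesPerDir j - 1 : ℕ) : ℝ) = (P.sitesPerDir j : ℝ) - 1 := by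
    rw [Nat.cast_sub (by omega), Nat.cast_one]
  simp only [plaq]
  rw [seamU1_apply_fst hne x, seamU1_apply_snd, seamU1_apply_fst hne (x.shift ν₀), seamU1_apply_snd, shift_apply_ne x hne]
  rcases val_shift_self x μ₀ with ⟨hlt, hval⟩ | ⟨heq, hval⟩
  · -- away from the seam slice: `e^{2πi(x_{μ₀}+1)/N²}·e^{−2πi x_{μ₀}/N²}`
    rw [if_neg (by omega), if_neg (by omega), hval, one_mul, inv_one, mul_one, ← Circle.exp_neg, ← Circle.exp_add]
    congr 1
    push_cast
    ring
  · rw [if_pos heq, if_pos heq, hval, heq]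
    rcases val_shift_self x ν₀ with ⟨-, hval1⟩ | ⟨heq1, hval1⟩
    · -- on the seam slice, away from the corner
      rw [hval1, ← Circle.exp_neg, ← Circle.exp_neg, ← Circle.exp_add, ← Circle.exp_add, ← Circle.exp_add]
      congr 1
      push_cast
      rw [hsub]
      field_simp
      ring
    · -- the corner: the exponent is `2π/N² − 2π`
      rw [hval1, heq1, ← Circle.exp_neg, ← Circle.exp_neg, ← Circle.exp_add, ← Circle.exp_add, ← Circle.exp_add,
        ← Circle.exp_sub_two_pi (2 * Real.pi / ((P.sitesPerDir j : ℝ) ^ 2))]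
      congr 1
      push_cast
      rw [hsub]
      field_simp
      ring

/-- off its plane the seam field has trivial plaquette variables. [cite: BalabanImbrieJaffe1985, (7.3.1) p.326] -/
theorem plaq_seamU1_of_ne {μ ν : Fin P.d} (hμν : μ < ν) (hne : ¬(μ = μ₀ ∧ ν = ν₀)) (hne' : ¬(μ = ν₀ ∧ ν = μ₀))
    (x : Balaban1983to89.Site P j) : plaq (seamU1 μ₀ ν₀) ⟨x, μ, ν, hμν⟩ = 1 := by
  have hμν' : μ ≠ ν := ne_of_lt hμν
  -- one of the two directions lies outside `{μ₀, ν₀}`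
  have hout : (μ ≠ μ₀ ∧ μ ≠ ν₀) ∨ (ν ≠ μ₀ ∧ ν ≠ ν₀) := by
    by_cases ha : μ = μ₀
    · right; exact ⟨fun hb => hμν' (ha.trans hb.symm), fun hb => hne ⟨ha, hb⟩⟩
    · by_cases hb : μ = ν₀
      · right; exact ⟨fun hc => hne' ⟨hb, hc⟩, fun hc => hμν' (hb.trans hc.symm)⟩
      · left; exact ⟨ha, hb⟩
  -- a step outside the plane does not change the plane bonds' variables
  have inv : ∀ {ρ : Fin P.d}, ρ ≠ μ₀ → ρ ≠ ν₀ → ∀ (y : Balaban1983to89.Site P j) (σ : Fin P.d),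
      seamU1 μ₀ ν₀ ⟨y.shift ρ, σ⟩ = seamU1 μ₀ ν₀ ⟨y, σ⟩ := by
    intro ρ h0 h1 y σ
    simp only [seamU1, shift_apply_ne y h0.symm, shift_apply_ne y h1.symm]
  simp only [plaq]
  rcases hout with ⟨h0, h1⟩ | ⟨h0, h1⟩
  · rw [seamU1_apply_of_ne h0 h1, seamU1_apply_of_ne h0 h1, inv h0 h1]; simp
  · rw [seamU1_apply_of_ne h0 h1, seamU1_apply_of_ne h0 h1, inv h0 h1]; simp

/-- `‖e^{it} − 1‖ ≤ |t|`. [folklore] -/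
private theorem norm_cexp_mul_I_sub_one_le (t : ℝ) : ‖exp ((t : ℂ) * I) - 1‖ ≤ |t| := by
  have h := Real.norm_exp_I_mul_ofReal_sub_one_le (x := t)
  rw [mul_comm, Real.norm_eq_abs] at h
  exact h

/-- **`|v(∂p) − 1| ≤ 2π/N²` AT EVERY PLAQUETTE** — the seam field meets any plaquette-smallness condition of the shape (7.3.1) once the torus is
large. [cite: BalabanImbrieJaffe1985, (7.3.1) p.326] -/
theorem norm_plaq_seamU1_sub_one_le (hμν₀ : μ₀ < ν₀) (p : Balaban1983to89.Plaq P j) :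
    ‖((plaq (seamU1 μ₀ ν₀) p : Circle) : ℂ) - 1‖ ≤ 2 * Real.pi / ((P.sitesPerDir j : ℝ) ^ 2) := by
  have hpos : 0 ≤ 2 * Real.pi / ((P.sitesPerDir j : ℝ) ^ 2) := by positivity
  obtain ⟨x, μ, ν, hμν⟩ := p
  by_cases h1 : μ = μ₀ ∧ ν = ν₀
  · obtain ⟨rfl, rfl⟩ := h1
    rw [plaq_seamU1_plane hμν x, Circle.coe_exp]
    exact (norm_cexp_mul_I_sub_one_le _).trans (le_of_eq (abs_of_nonneg hpos))
  · have h2 : ¬(μ = ν₀ ∧ ν = μ₀) := by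
      rintro ⟨rfl, rfl⟩; exact lt_asymm hμν hμν₀
    rw [plaq_seamU1_of_ne hμν h1 h2 x]
    simp [hpos]

/-- **THE SEAM FIELD HAS FLUX `1`** through every `(μ₀, ν₀)`-coordinate 2-torus: its `N²` principal plaquette angles are all `2π/N²`.
[cite: BalabanImbrieJaffe1985, (7.3.1) p.326] -/
theorem fluxU_seamU1 (hμν₀ : μ₀ < ν₀) (x : Balaban1983to89.Site P j) : fluxU (seamU1 μ₀ ν₀) x μ₀ ν₀ hμν₀ = 1 := by
  apply fluxU_eq_of_angSum_eq
  have hN2 : 2 ≤ P.sitesPerDir j := two_le_sitesPerDir P j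
  have hNR : (2 : ℝ) ≤ P.sitesPerDir j := by exact_mod_cast hN2
  have h4 : (4 : ℝ) ≤ (P.sitesPerDir j : ℝ) ^ 2 := by nlinarith
  have hlt : 2 * Real.pi / ((P.sitesPerDir j : ℝ) ^ 2) < Real.pi := by
    rw [div_lt_iff₀ (by positivity)]; nlinarith [Real.pi_pos]
  have h0 : 0 ≤ 2 * Real.pi / ((P.sitesPerDir j : ℝ) ^ 2) := by positivity
  have hang : ∀ s t, argB ((plaq (seamU1 μ₀ ν₀) ⟨secSite x μ₀ ν₀ s t, μ₀, ν₀, hμν₀⟩ : Circle) : ℂ)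
      = 2 * Real.pi / ((P.sitesPerDir j : ℝ) ^ 2) := by
    intro s t
    rw [plaq_seamU1_plane hμν₀, Circle.coe_exp]
    exact argB_exp_mul_I ⟨by linarith [Real.pi_pos], hlt⟩
  unfold angSum
  simp_rw [hang]
  rw [Finset.sum_const, Finset.sum_const, Finset.card_univ, ZMod.card, smul_smul, nsmul_eq_mul]
  have hN0 : (P.sitesPerDir j : ℝ) ≠ 0 := by positivity
  push_cast
  field_simp

/-- **(7.3.1) ADMITS NONZERO-FLUX SECTORS** (headline, quantifier form): for every `ε > 0` (e.g. `ε = e_k𝓅(e_k)`) and every level `j` of every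
torus of record with `N_j² ≥ 2π/ε`, and every plane `μ₀ < ν₀`, there is a unit-lattice `U(1)` field with `|v(∂p) − 1| ≤ ε` at EVERY plaquette —
the printed hypothesis (7.3.1) — whose flux through every `(μ₀, ν₀)`-coordinate 2-torus is `1`. [cite: BalabanImbrieJaffe1985, (7.3.1) p.326] -/
theorem exists_hyp731Shape_flux_one (hμν₀ : μ₀ < ν₀) {ε : ℝ} (hε : 0 < ε) (hlarge : 2 * Real.pi / ε ≤ (P.sitesPerDir j : ℝ) ^ 2) :
    ∃ v : U1Field P j, (∀ p : Balaban1983to89.Plaq P j, ‖((plaq v p : Circle) : ℂ) - 1‖ ≤ ε) ∧ ∀ x : Balaban1983to89.Site P j, fluxU v x μ₀ ν₀ hμν₀ = 1 := by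
  refine ⟨seamU1 μ₀ ν₀, fun p => (norm_plaq_seamU1_sub_one_le hμν₀ p).trans ?_, fun x => fluxU_seamU1 hμν₀ x⟩
  have hN : (0 : ℝ) < (P.sitesPerDir j : ℝ) ^ 2 := by
    have := two_le_sitesPerDir P j
    have : (2 : ℝ) ≤ P.sitesPerDir j := by exact_mod_cast this
    positivity
  rw [div_le_iff₀ hN]
  rw [div_le_iff₀ hε] at hlarge
  nlinarith

end Seam

/-! ## §5  The pull-back `Q^{s*}_kv` of (4.5.2)–(4.5.3) and the actual background `u_k` of (4.5.4) carry the flux of `v` -/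

section PullBack

variable {i : ℕ}

/-- `translate62` is symmetric (`U(1)` is abelian). [cite: BalabanImbrieJaffe1985, (6.2) p.318] -/
theorem translate62_comm (u w : U1Field P j) : translate62 u w = translate62 w u := by
  funext b
  simp only [translate62, mul_comm]

/-- the site of the `(μ, ν)`-plane through `x` with ABSOLUTE plane labels `(a, b)`. [cite: BalabanImbrieJaffe1985, (7.3.1) p.326] -/
def planeSite (x : Balaban1983to89.Site P j) (μ ν : Fin P.d) (a b : ZMod (P.sitesPerDir j)) : Balaban1983to89.Site P j :=
  fun ρ => if ρ = μ then a else if ρ = ν then b else x ρ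

/-- the `μ`-label of a plane site. [cite: BalabanImbrieJaffe1985, (7.3.1) p.326] -/
@[simp] theorem planeSite_apply_fst (x : Balaban1983to89.Site P j) (μ ν : Fin P.d) (a b : ZMod (P.sitesPerDir j)) :
    planeSite x μ ν a b μ = a := by
  simp [planeSite]

/-- the `ν`-label of a plane site. [cite: BalabanImbrieJaffe1985, (7.3.1) p.326] -/
theorem planeSite_apply_snd (x : Balaban1983to89.Site P j) {μ ν : Fin P.d} (hμν : μ ≠ ν) (a b : ZMod (P.sitesPerDir j)) :
    planeSite x μ ν a b ν = b := by
  simp [planeSite, hμν.symm]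

/-- the section sites in absolute labels. [cite: BalabanImbrieJaffe1985, (7.3.1) p.326] -/
theorem secSite_eq_planeSite (x : Balaban1983to89.Site P j) (μ ν : Fin P.d) (s t : ZMod (P.sitesPerDir j)) :
    secSite x μ ν s t = planeSite x μ ν (x μ + s) (x ν + t) := rfl

/-- the angle sum in absolute labels (translation of the summation variables). [cite: BalabanImbrieJaffe1985, (7.3.1) p.326] -/
theorem angSum_eq_sum_planeSite (u : U1Field P j) (x : Balaban1983to89.Site P j) {μ ν : Fin P.d} (h : μ < ν) :
    angSum u x μ ν h = ∑ a : ZMod (P.sitesPerDir j), ∑ b : ZMod (P.sitesPerDir j),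
      argB ((plaq u ⟨planeSite x μ ν a b, μ, ν, h⟩ : Circle) : ℂ) := by
  unfold angSum
  simp_rw [secSite_eq_planeSite]
  exact Fintype.sum_equiv (Equiv.addLeft (x μ)) _ _
    (fun s => Fintype.sum_equiv (Equiv.addLeft (x ν)) _ _ (fun t => rfl))

/-- sizes along the tower: `N_i = N_{i+k}·L^k` (standing range). [cite: BalabanImbrieJaffe1985, (2.24) p.305] -/
theorem sitesPerDir_eq_mul_pow : ∀ (k : ℕ), i + k ≤ P.m + P.K → P.sitesPerDir i = P.sitesPerDir (i + k) * P.L ^ k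
  | 0, _ => by simp
  | k + 1, hk => by
    show P.sitesPerDir i = P.sitesPerDir (i + k + 1) * P.L ^ (k + 1)
    rw [sitesPerDir_eq_mul_pow k (by omega), P.sitesPerDir_eq_mul_succ (show i + k + 1 ≤ P.m + P.K by omega)]
    ring

/-- the labels of the k-fold block point: integer division by `L^k` (standing range). [cite: BalabanImbrieJaffe1985, (2.24) p.305] -/
theorem val_blockOfIter : ∀ (k : ℕ), i + k ≤ P.m + P.K → ∀ (x : Balaban1983to89.Site P i) (μ : Fin P.d),
    ((blockOfIter k x) μ).val = (x μ).val / P.L ^ k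
  | 0, _, x, μ => by simp
  | k + 1, hk, x, μ => by
    rw [blockOfIter_succ, Balaban1983to89.Site.val_blockOf (show i + k + 1 ≤ P.m + P.K by omega), val_blockOfIter k (by omega) x μ, pow_succ,
      Nat.div_div_eq_div_mul]

/-- the `μ`-label of `x + e_μ`. [folklore] -/
private theorem val_shift_self_mod (x : Balaban1983to89.Site P j) (μ : Fin P.d) :
    ((x.shift μ) μ).val = ((x μ).val + 1) % P.sitesPerDir j := by
  have h2 := two_le_sitesPerDir P j
  rw [show x.shift μ μ = x μ + 1 by simp [Balaban1983to89.Site.shift], ZMod.val_add, ZMod.val_one_eq_one_mod,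
    Nat.mod_eq_of_lt (show 1 < P.sitesPerDir j by omega)]

/-- **THE k-FOLD EDGE CONDITION IN LABELS**: the k-block of `x + e_μ` is the `μ`-neighbour of the k-block of `x` iff
`x_μ ≡ L^k − 1 (mod L^k)` (including the wrap-around of the torus; standing range). [cite: BalabanImbrieJaffe1985, (2.24) p.305] -/
theorem blockOfIter_shift_iff {k : ℕ} (hk : i + k ≤ P.m + P.K) (x : Balaban1983to89.Site P i) (μ : Fin P.d) :
    blockOfIter k (x.shift μ) = (blockOfIter k x).shift μ ↔ (x μ).val % P.L ^ k = P.L ^ k - 1 := by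
  have hT0 : 0 < P.L ^ k := pow_pos P.L_pos k
  have hN : P.sitesPerDir i = P.sitesPerDir (i + k) * P.L ^ k := sitesPerDir_eq_mul_pow k hk
  have h2' : 2 ≤ P.sitesPerDir (i + k) := two_le_sitesPerDir P (i + k)
  have haN : (x μ).val < P.sitesPerDir (i + k) * P.L ^ k := by rw [← hN]; exact ZMod.val_lt _
  have hdm : P.L ^ k * ((x μ).val / P.L ^ k) + (x μ).val % P.L ^ k = (x μ).val := Nat.div_add_mod _ _
  have hrT : (x μ).val % P.L ^ k < P.L ^ k := Nat.mod_lt _ hT0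
  have hqN : (x μ).val / P.L ^ k < P.sitesPerDir (i + k) := Nat.div_lt_of_lt_mul (by rwa [mul_comm] at haN)
  have hA : P.L ^ k * ((x μ).val / P.L ^ k) + P.L ^ k ≤ P.sitesPerDir i :=
    calc P.L ^ k * ((x μ).val / P.L ^ k) + P.L ^ k = P.L ^ k * ((x μ).val / P.L ^ k + 1) := by ring
      _ ≤ P.L ^ k * P.sitesPerDir (i + k) := Nat.mul_le_mul_left _ hqN
      _ = P.sitesPerDir i := by rw [hN, mul_comm]
  -- the `μ`-labels of the two sides
  have hL : ((blockOfIter k (x.shift μ)) μ).val = (((x μ).val + 1) % P.sitesPerDir i) / P.L ^ k := by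
    rw [val_blockOfIter k hk, val_shift_self_mod]
  have hR : (((blockOfIter k x).shift μ) μ).val = ((x μ).val / P.L ^ k + 1) % P.sitesPerDir (i + k) := by
    rw [val_shift_self_mod, val_blockOfIter k hk]
  constructor
  · intro h
    by_contra hne
    have hlt : (x μ).val % P.L ^ k + 1 < P.L ^ k := by omega
    have ha1 : (x μ).val + 1 < P.sitesPerDir i := by omega
    have h1 : ((blockOfIter k (x.shift μ)) μ).val = (x μ).val / P.L ^ k := by
      rw [hL, Nat.mod_eq_of_lt ha1,
        show (x μ).val + 1 = P.L ^ k * ((x μ).val / P.L ^ k) + ((x μ).val % P.L ^ k + 1) by omega,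
        Nat.mul_add_div hT0, Nat.div_eq_of_lt hlt, add_zero]
    have h2 : ((blockOfIter k (x.shift μ)) μ).val = (((blockOfIter k x).shift μ) μ).val := by rw [h]
    rw [h1, hR] at h2
    by_cases hq1 : (x μ).val / P.L ^ k + 1 < P.sitesPerDir (i + k)
    · rw [Nat.mod_eq_of_lt hq1] at h2; omega
    · rw [show (x μ).val / P.L ^ k + 1 = P.sitesPerDir (i + k) by omega, Nat.mod_self] at h2; omega
  · intro hmod
    -- one block further, with the wrap-around: `(T(q+1) mod TN')/T = (q+1) mod N'`
    have key : ∀ q : ℕ, P.L ^ k * (q + 1) % P.sitesPerDir i / P.L ^ k = (q + 1) % P.sitesPerDir (i + k) := by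
      intro q
      rw [hN, mul_comm (P.sitesPerDir (i + k)) (P.L ^ k), Nat.mul_mod_mul_left, Nat.mul_div_cancel_left _ hT0]
    funext ρ
    apply ZMod.val_injective
    by_cases hρ : ρ = μ
    · rw [hρ, hL, hR, show (x μ).val + 1 = P.L ^ k * ((x μ).val / P.L ^ k) + P.L ^ k by omega,
        show P.L ^ k * ((x μ).val / P.L ^ k) + P.L ^ k = P.L ^ k * ((x μ).val / P.L ^ k + 1) by ring]
      exact key _
    · rw [val_blockOfIter k hk (x.shift μ) ρ, shift_apply_ne x hρ, shift_apply_ne (blockOfIter k x) hρ, val_blockOfIter k hk x ρ]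

/-- **ONE EDGE LABEL PER BLOCK**: summing over the labels `a ≡ L^k − 1 (mod L^k)` of `ℤ/N_i` is summing over their block labels
`a / L^k ∈ ℤ/N_{i+k}` (the map is a bijection; standing range). [cite: BalabanImbrieJaffe1985, (2.24) p.305] -/
theorem sum_edge_eq {k : ℕ} (hk : i + k ≤ P.m + P.K) (G : ZMod (P.sitesPerDir (i + k)) → ℝ) :
    (∑ a : ZMod (P.sitesPerDir i),
        if a.val % P.L ^ k = P.L ^ k - 1 then G (((a.val / P.L ^ k : ℕ)) : ZMod (P.sitesPerDir (i + k))) else 0)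
      = ∑ a' : ZMod (P.sitesPerDir (i + k)), G a' := by
  have hT0 : 0 < P.L ^ k := pow_pos P.L_pos k
  have hN : P.sitesPerDir i = P.sitesPerDir (i + k) * P.L ^ k := sitesPerDir_eq_mul_pow k hk
  -- the inverse map lands below `N_i` and on an edge label
  have hbd : ∀ a' : ZMod (P.sitesPerDir (i + k)), a'.val * P.L ^ k + (P.L ^ k - 1) < P.sitesPerDir i := by
    intro a'
    have h1 := Nat.mul_le_mul_right (P.L ^ k) (Nat.succ_le_of_lt (ZMod.val_lt a'))
    rw [Nat.succ_mul] at h1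
    omega
  have hmodinv : ∀ a' : ZMod (P.sitesPerDir (i + k)), (a'.val * P.L ^ k + (P.L ^ k - 1)) % P.L ^ k = P.L ^ k - 1 := by
    intro a'
    rw [add_comm, Nat.add_mul_mod_self_right, Nat.mod_eq_of_lt (by omega)]
  have hdivinv : ∀ a' : ZMod (P.sitesPerDir (i + k)), (a'.val * P.L ^ k + (P.L ^ k - 1)) / P.L ^ k = a'.val := by
    intro a'
    rw [add_comm, Nat.add_mul_div_right _ _ hT0, Nat.div_eq_of_lt (by omega), zero_add]
  rw [← Finset.sum_filter]
  refine Finset.sum_nbij' (fun a => (((a.val / P.L ^ k : ℕ)) : ZMod (P.sitesPerDir (i + k))))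
    (fun a' => (((a'.val * P.L ^ k + (P.L ^ k - 1) : ℕ)) : ZMod (P.sitesPerDir i))) ?_ ?_ ?_ ?_ ?_
  · intro a _; exact Finset.mem_univ _
  · intro a' _
    rw [Finset.mem_filter]
    refine ⟨Finset.mem_univ _, ?_⟩
    rw [ZMod.val_natCast, Nat.mod_eq_of_lt (hbd a'), hmodinv]
  · intro a ha
    rw [Finset.mem_filter] at ha
    have hq : a.val / P.L ^ k < P.sitesPerDir (i + k) :=
      Nat.div_lt_of_lt_mul (by rw [mul_comm, ← hN]; exact ZMod.val_lt a)
    have hre : a.val / P.L ^ k * P.L ^ k + (P.L ^ k - 1) = a.val := by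
      have := Nat.div_add_mod' a.val (P.L ^ k)
      rw [ha.2] at this
      exact this
    rw [ZMod.val_natCast, Nat.mod_eq_of_lt hq, hre, ZMod.natCast_zmod_val]
  · intro a' _
    rw [ZMod.val_natCast, Nat.mod_eq_of_lt (hbd a'), hdivinv, ZMod.natCast_zmod_val]
  · intro a _; rfl

/-- the k-fold block point of a plane site is the plane site of the block labels. [cite: BalabanImbrieJaffe1985, (2.24) p.305] -/
theorem blockOfIter_planeSite {k : ℕ} (hk : i + k ≤ P.m + P.K) (x : Balaban1983to89.Site P i) (μ ν : Fin P.d) (a b : ZMod (P.sitesPerDir i)) :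
    blockOfIter k (planeSite x μ ν a b) =
      planeSite (blockOfIter k x) μ ν (((a.val / P.L ^ k : ℕ)) : ZMod (P.sitesPerDir (i + k)))
        (((b.val / P.L ^ k : ℕ)) : ZMod (P.sitesPerDir (i + k))) := by
  have hN : P.sitesPerDir i = P.sitesPerDir (i + k) * P.L ^ k := sitesPerDir_eq_mul_pow k hk
  have hdiv : ∀ c : ZMod (P.sitesPerDir i), c.val / P.L ^ k < P.sitesPerDir (i + k) := fun c =>
    Nat.div_lt_of_lt_mul (by rw [mul_comm, ← hN]; exact ZMod.val_lt c)
  funext ρ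
  apply ZMod.val_injective
  rw [val_blockOfIter k hk]
  by_cases h1 : ρ = μ
  · rw [h1, planeSite_apply_fst, planeSite_apply_fst, ZMod.val_natCast, Nat.mod_eq_of_lt (hdiv a)]
  · by_cases h2 : ρ = ν
    · have hνμ : μ ≠ ν := fun h => h1 (h2.trans h.symm)
      rw [h2, planeSite_apply_snd x hνμ, planeSite_apply_snd _ hνμ, ZMod.val_natCast, Nat.mod_eq_of_lt (hdiv b)]
    · simp only [planeSite, if_neg h1, if_neg h2]
      rw [val_blockOfIter k hk]

/-- **THE PLAQUETTE VARIABLES OF THE PULL-BACK ALONG A FINE SECTION** ((4.5.3) ⇒ `BIJ85Eq454Holonomy.plaq_QsstarU1_of_mem/_of_not_mem`):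
at the plane site with labels `(a, b)`, `(Q^{s*}_kv)(∂p) = v(∂p′)` with `p′` the unit plaquette at the block labels `(a/L^k, b/L^k)` if both
`a, b ≡ L^k − 1 (mod L^k)` (the corner plaquettes of the section), and `1` otherwise; `v = exp(ie_kB)` ((4.5.1)), `ηL^k = 1`, `2 ≤ d`,
standing range. [cite: BalabanImbrieJaffe1985, (4.5.3) p.312] -/
theorem plaq_QsstarU1_planeSite (hd : 2 ≤ P.d) {k : ℕ} (hk : i + k ≤ P.m + P.K) (e η : ℝ) (hη : η * (P.L : ℝ) ^ k = 1)
    (B : PBond P (i + k) → ℝ) (x : Balaban1983to89.Site P i) {μ ν : Fin P.d} (h : μ < ν) (a b : ZMod (P.sitesPerDir i)) :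
    plaq (expField (e * η) ((torusBlockBondsIter P i k).Qsstar B)) ⟨planeSite x μ ν a b, μ, ν, h⟩ =
      if a.val % P.L ^ k = P.L ^ k - 1 ∧ b.val % P.L ^ k = P.L ^ k - 1 then
        plaq (expField e B) ⟨planeSite (blockOfIter k x) μ ν (((a.val / P.L ^ k : ℕ)) : ZMod (P.sitesPerDir (i + k)))
          (((b.val / P.L ^ k : ℕ)) : ZMod (P.sitesPerDir (i + k))), μ, ν, h⟩
      else 1 := by
  have hne : μ ≠ ν := ne_of_lt h
  have hcross : (blockOfIter k ((planeSite x μ ν a b).shift μ) = (blockOfIter k (planeSite x μ ν a b)).shift μ ∧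
      blockOfIter k ((planeSite x μ ν a b).shift ν) = (blockOfIter k (planeSite x μ ν a b)).shift ν) ↔
      (a.val % P.L ^ k = P.L ^ k - 1 ∧ b.val % P.L ^ k = P.L ^ k - 1) := by
    rw [blockOfIter_shift_iff hk, blockOfIter_shift_iff hk, planeSite_apply_fst, planeSite_apply_snd x hne]
  split_ifs with hc
  · have hmem : (⟨planeSite x μ ν a b, μ, ν, h⟩ : Balaban1983to89.Plaq P i) ∈ (torusEdgeCellsIter P i k hd).B
        ⟨planeSite (blockOfIter k x) μ ν (((a.val / P.L ^ k : ℕ)) : ZMod (P.sitesPerDir (i + k)))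
          (((b.val / P.L ^ k : ℕ)) : ZMod (P.sitesPerDir (i + k))), μ, ν, h⟩ := by
      rw [mem_edgeBIter_iff]
      exact ⟨hcross.2 hc, by simp only [blockOfIter_planeSite hk]⟩
    exact plaq_QsstarU1_of_mem hd hk e η hη B hmem
  · apply plaq_QsstarU1_of_not_mem hd hk
    intro p' hp
    rw [mem_edgeBIter_iff] at hp
    exact hc (hcross.1 hp.1)

/-- **THE PULL-BACK CARRIES THE ANGLE SUM OF `v`**: along every fine `(μ, ν)`-section of `T^{(i)}` the principal plaquette angles of
`Q^{s*}_kv` are those of `v` along the unit `(μ, ν)`-section through the block point (one corner plaquette per unit plaquette) and `0`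
elsewhere — EXACT, no smallness. [cite: BalabanImbrieJaffe1985, (4.5.3) p.312] -/
theorem angSum_QsstarU1 (hd : 2 ≤ P.d) {k : ℕ} (hk : i + k ≤ P.m + P.K) (e η : ℝ) (hη : η * (P.L : ℝ) ^ k = 1)
    (B : PBond P (i + k) → ℝ) (x : Balaban1983to89.Site P i) {μ ν : Fin P.d} (h : μ < ν) :
    angSum (expField (e * η) ((torusBlockBondsIter P i k).Qsstar B)) x μ ν h = angSum (expField e B) (blockOfIter k x) μ ν h := by
  rw [angSum_eq_sum_planeSite, angSum_eq_sum_planeSite]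
  have hterm : ∀ a b : ZMod (P.sitesPerDir i),
      argB ((plaq (expField (e * η) ((torusBlockBondsIter P i k).Qsstar B)) ⟨planeSite x μ ν a b, μ, ν, h⟩ : Circle) : ℂ)
        = if a.val % P.L ^ k = P.L ^ k - 1 then
            (if b.val % P.L ^ k = P.L ^ k - 1 then
              argB ((plaq (expField e B) ⟨planeSite (blockOfIter k x) μ ν
                (((a.val / P.L ^ k : ℕ)) : ZMod (P.sitesPerDir (i + k))) (((b.val / P.L ^ k : ℕ)) : ZMod (P.sitesPerDir (i + k))),
                μ, ν, h⟩ : Circle) : ℂ)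
            else 0)
          else 0 := by
    intro a b
    rw [plaq_QsstarU1_planeSite hd hk e η hη B x h a b]
    by_cases ha : a.val % P.L ^ k = P.L ^ k - 1
    · by_cases hb : b.val % P.L ^ k = P.L ^ k - 1
      · rw [if_pos ⟨ha, hb⟩, if_pos ha, if_pos hb]
      · rw [if_neg (fun hc => hb hc.2), if_pos ha, if_neg hb, Circle.coe_one, argB_one]
    · rw [if_neg (fun hc => ha hc.1), if_neg ha, Circle.coe_one, argB_one]
  simp_rw [hterm]
  have hinner : ∀ a : ZMod (P.sitesPerDir i),
      (∑ b : ZMod (P.sitesPerDir i),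
        if a.val % P.L ^ k = P.L ^ k - 1 then
          (if b.val % P.L ^ k = P.L ^ k - 1 then
            argB ((plaq (expField e B) ⟨planeSite (blockOfIter k x) μ ν
              (((a.val / P.L ^ k : ℕ)) : ZMod (P.sitesPerDir (i + k))) (((b.val / P.L ^ k : ℕ)) : ZMod (P.sitesPerDir (i + k))),
              μ, ν, h⟩ : Circle) : ℂ)
          else 0)
        else 0)
      = if a.val % P.L ^ k = P.L ^ k - 1 then
          ∑ b' : ZMod (P.sitesPerDir (i + k)),
            argB ((plaq (expField e B) ⟨planeSite (blockOfIter k x) μ ν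
              (((a.val / P.L ^ k : ℕ)) : ZMod (P.sitesPerDir (i + k))) b', μ, ν, h⟩ : Circle) : ℂ)
        else 0 := by
    intro a
    split_ifs with ha
    · exact sum_edge_eq hk (fun b' => argB ((plaq (expField e B) ⟨planeSite (blockOfIter k x) μ ν
        (((a.val / P.L ^ k : ℕ)) : ZMod (P.sitesPerDir (i + k))) b', μ, ν, h⟩ : Circle) : ℂ))
    · simp
  simp_rw [hinner]
  exact sum_edge_eq hk (fun a' => ∑ b' : ZMod (P.sitesPerDir (i + k)),
    argB ((plaq (expField e B) ⟨planeSite (blockOfIter k x) μ ν a' b', μ, ν, h⟩ : Circle) : ℂ))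

/-- **THE PULL-BACK `Q^{s*}_kv` HAS THE FLUX OF `v`**: `flux(Q^{s*}_kv)` through the fine `(μ, ν)`-section through `x` equals `flux(v)`
through the unit `(μ, ν)`-section through the k-block point of `x` — EXACT, for every `v = exp(ie_kB)` (`ηL^k = 1`, `2 ≤ d`, standing
range). [cite: BalabanImbrieJaffe1985, (4.5.3) p.312] -/
theorem fluxU_QsstarU1 (hd : 2 ≤ P.d) {k : ℕ} (hk : i + k ≤ P.m + P.K) (e η : ℝ) (hη : η * (P.L : ℝ) ^ k = 1)
    (B : PBond P (i + k) → ℝ) (x : Balaban1983to89.Site P i) {μ ν : Fin P.d} (h : μ < ν) :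
    fluxU (expField (e * η) ((torusBlockBondsIter P i k).Qsstar B)) x μ ν h = fluxU (expField e B) (blockOfIter k x) μ ν h :=
  fluxU_eq_of_angSum_eq _ _ h (by rw [angSum_QsstarU1 hd hk e η hη B x h, angSum_eq_two_pi_mul_fluxU])

/-- **THE ACTUAL BACKGROUND `u_k = (Q^{s*}_kv)·exp[−ie_kηX]` OF (4.5.4) HAS THE FLUX OF `v`** whenever the principal plaquette angles of
`v` and the circulations `e_kη(∂X)(p)` are `< π/2` in absolute value (the former is (7.3.1) with `e_k𝓅(e_k) < 1`; the latter is the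
smallness of `X = 𝒟_k∂^*Q^{e*}_kf^{(k)}` that (4.2.6) provides): §3 applied to the exact factor, §5 to the pull-back.
[cite: BalabanImbrieJaffe1985, (4.5.4) p.313, (7.3.1) p.326] -/
theorem fluxU_background454 (hd : 2 ≤ P.d) {k : ℕ} (hk : i + k ≤ P.m + P.K) (e η : ℝ) (hη : η * (P.L : ℝ) ^ k = 1)
    (B : PBond P (i + k) → ℝ) (X : PBond P i → ℝ) (x : Balaban1983to89.Site P i) {μ ν : Fin P.d} (h : μ < ν)
    (hv : ∀ p' : Balaban1983to89.Plaq P (i + k), |argB ((plaq (expField e B) p' : Circle) : ℂ)| < Real.pi / 2)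
    (hX : ∀ p : Balaban1983to89.Plaq P i, |e * η * curl1 X p| < Real.pi / 2) :
    fluxU (expField (e * η) (fun b => (torusBlockBondsIter P i k).Qsstar B b - X b)) x μ ν h
      = fluxU (expField e B) (blockOfIter k x) μ ν h := by
  rw [expField_background_eq_translate62, translate62_comm, fluxU_translate62_expField _ _ _ x h ?_ ?_,
    fluxU_QsstarU1 hd hk e η hη B x h]
  · intro s t
    rw [secSite_eq_planeSite, plaq_QsstarU1_planeSite hd hk e η hη B x h]
    split_ifs
    · exact hv _
    · rw [Circle.coe_one, argB_one, abs_zero]; positivity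
  · intro s t
    have : e * η * curl1 (fun b => -X b) ⟨secSite x μ ν s t, μ, ν, h⟩ = -(e * η * curl1 X ⟨secSite x μ ν s t, μ, ν, h⟩) := by
      simp only [curl1]; ring
    rw [this, abs_neg]
    exact hX _

/-- away from the top level the tori have at least `2L ≥ 4 ≥ 3` sites per direction. [cite: BalabanImbrieJaffe1985, (7.3.1) p.326] -/
theorem three_le_sitesPerDir (hj : j < P.m + P.K) : 3 ≤ P.sitesPerDir j := by
  unfold Params.sitesPerDir
  have hL : 2 ≤ P.L := P.hL.2
  have : P.L ≤ P.L ^ (P.m + P.K - j) := by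
    calc P.L = P.L ^ 1 := (pow_one _).symm
      _ ≤ P.L ^ (P.m + P.K - j) := Nat.pow_le_pow_right P.L_pos (by omega)
  omega

/-- `2π/N² < π`. [cite: BalabanImbrieJaffe1985, (7.3.1) p.326] -/
private theorem two_pi_div_sq_lt_pi (j : ℕ) : 2 * Real.pi / ((P.sitesPerDir j : ℝ) ^ 2) < Real.pi := by
  have hNR : (2 : ℝ) ≤ P.sitesPerDir j := by exact_mod_cast two_le_sitesPerDir P j
  have h4 : (4 : ℝ) ≤ (P.sitesPerDir j : ℝ) ^ 2 := by nlinarith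
  rw [div_lt_iff₀ (by positivity)]
  nlinarith [Real.pi_pos]

/-- the principal plaquette angles of the seam field are all within `2π/N²` of `0`. [cite: BalabanImbrieJaffe1985, (7.3.1) p.326] -/
theorem abs_argB_plaq_seamU1_le {μ₀ ν₀ : Fin P.d} (hμν₀ : μ₀ < ν₀) (p : Balaban1983to89.Plaq P j) :
    |argB ((plaq (seamU1 μ₀ ν₀) p : Circle) : ℂ)| ≤ 2 * Real.pi / ((P.sitesPerDir j : ℝ) ^ 2) := by
  have hpos : 0 ≤ 2 * Real.pi / ((P.sitesPerDir j : ℝ) ^ 2) := by positivity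
  obtain ⟨x, μ, ν, hμν⟩ := p
  by_cases h1 : μ = μ₀ ∧ ν = ν₀
  · obtain ⟨rfl, rfl⟩ := h1
    rw [plaq_seamU1_plane hμν x, Circle.coe_exp,
      argB_exp_mul_I ⟨by linarith [Real.pi_pos], two_pi_div_sq_lt_pi (P := P) j⟩, abs_of_nonneg hpos]
  · have h2 : ¬(μ = ν₀ ∧ ν = μ₀) := by
      rintro ⟨rfl, rfl⟩; exact lt_asymm hμν hμν₀
    rw [plaq_seamU1_of_ne hμν h1 h2 x, Circle.coe_one, argB_one, abs_zero]
    exact hpos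

/-- **THE ACTUAL BACKGROUNDS (4.5.4) OVER (7.3.1)-SMALL `v` FILL THE NONZERO-FLUX SECTORS** (headline of §5): at every level with
`N_{i+k} ≥ 3` (every level below the top, `three_le_sitesPerDir`), for every coupling `e ≠ 0`, `ηL^k = 1`, every plane `μ₀ < ν₀` and every
`X` with `|e_kη(∂X)(p)| < π/2`, there is a unit-lattice field `v = exp(ie_kB)` with `|v(∂p′) − 1| ≤ 2π/N_{i+k}²` at EVERY unit plaquette —
(7.3.1) as soon as `N_{i+k}² ≥ 2π/(e_k𝓅(e_k))` — whose background `u_k = (Q^{s*}_kv)·exp[−ie_kηX]` has flux `1` through EVERY fine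
`(μ₀, ν₀)`-coordinate 2-torus of `T^{(i)}`. [cite: BalabanImbrieJaffe1985, (4.5.4) p.313, (7.3.1) p.326] -/
theorem exists_flux_one_background454 (hd : 2 ≤ P.d) {k : ℕ} (hk : i + k ≤ P.m + P.K) (h3 : 3 ≤ P.sitesPerDir (i + k))
    {e : ℝ} (he : e ≠ 0) (η : ℝ) (hη : η * (P.L : ℝ) ^ k = 1) (X : PBond P i → ℝ)
    (hX : ∀ p : Balaban1983to89.Plaq P i, |e * η * curl1 X p| < Real.pi / 2) {μ₀ ν₀ : Fin P.d} (hμν₀ : μ₀ < ν₀) :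
    ∃ B : PBond P (i + k) → ℝ,
      (∀ p' : Balaban1983to89.Plaq P (i + k), ‖((plaq (expField e B) p' : Circle) : ℂ) - 1‖ ≤ 2 * Real.pi / ((P.sitesPerDir (i + k) : ℝ) ^ 2)) ∧
      ∀ x : Balaban1983to89.Site P i, fluxU (expField (e * η) (fun b => (torusBlockBondsIter P i k).Qsstar B b - X b)) x μ₀ ν₀ hμν₀ = 1 := by
  -- `v = exp(ie_kB)` with `B = (ie_k)^{−1} ln v` ((4.5.1)) for the seam field `v`
  have hv : expField e (bondPotential e (seamU1 (P := P) (j := i + k) μ₀ ν₀)) = seamU1 μ₀ ν₀ := by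
    funext b
    exact Circle.ext (by rw [expField, Circle.coe_exp]; exact exp_bondPotential e he _ b)
  have h9 : (9 : ℝ) ≤ (P.sitesPerDir (i + k) : ℝ) ^ 2 := by
    have : (3 : ℝ) ≤ P.sitesPerDir (i + k) := by exact_mod_cast h3
    nlinarith
  have hsmall : 2 * Real.pi / ((P.sitesPerDir (i + k) : ℝ) ^ 2) < Real.pi / 2 := by
    rw [div_lt_iff₀ (by positivity)]
    nlinarith [Real.pi_pos]
  refine ⟨bondPotential e (seamU1 μ₀ ν₀), fun p' => by rw [hv]; exact norm_plaq_seamU1_sub_one_le hμν₀ p', fun x => ?_⟩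
  rw [fluxU_background454 hd hk e η hη _ X x hμν₀ (fun p' => by rw [hv]; exact (abs_argB_plaq_seamU1_le hμν₀ p').trans_lt hsmall) hX,
    hv, fluxU_seamU1 hμν₀]

end PullBack

/-! ## §6  No gauge makes a nonzero-flux field `exp(iκA)` with all circulations `|κ(∂A)(p)| < π` — on BIJ85's own carriers -/

section NoGlobalGauge

variable {i : ℕ}

/-- the flux is a function of the plaquette variables. [cite: BalabanImbrieJaffe1985, (7.3.1) p.326] -/
theorem fluxU_congr_plaq {u u' : U1Field P j} (hp : ∀ p : Balaban1983to89.Plaq P j, plaq u' p = plaq u p) (x : Balaban1983to89.Site P j)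
    {μ ν : Fin P.d} (h : μ < ν) : fluxU u' x μ ν h = fluxU u x μ ν h := by
  apply fluxU_eq_of_angSum_eq
  rw [← angSum_eq_two_pi_mul_fluxU u x h]
  unfold angSum
  simp_rw [hp]

/-- **THE FLUX IS GAUGE INVARIANT** ((2.7): `u(∂p)` is). [cite: BalabanImbrieJaffe1985, (2.7) p.303] -/
theorem fluxU_gaugeU (g : Balaban1983to89.Site P j → Circle) (u : U1Field P j) (x : Balaban1983to89.Site P j) {μ ν : Fin P.d}
    (h : μ < ν) : fluxU (gaugeU g u) x μ ν h = fluxU u x μ ν h :=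
  fluxU_congr_plaq (fun p => plaq_gauge g u p) x h

/-- **A FIELD `exp(iκA)` WITH ALL CIRCULATIONS `|κ(∂A)(p)| < π` ALONG A SECTION HAS FLUX `0` THERE**: its principal plaquette angles ARE
the circulations, which sum to `0` (Stokes). [cite: BalabanImbrieJaffe1985, (6.4) p.318, (7.3.1) p.326] -/
theorem fluxU_expField_eq_zero (κ : ℝ) (A : PBond P j → ℝ) (x : Balaban1983to89.Site P j) {μ ν : Fin P.d} (h : μ < ν)
    (hA : ∀ s t, |κ * curl1 A ⟨secSite x μ ν s t, μ, ν, h⟩| < Real.pi) : fluxU (expField κ A) x μ ν h = 0 := by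
  apply fluxU_eq_of_angSum_eq
  unfold angSum
  have hterm : ∀ s t, argB ((plaq (expField κ A) ⟨secSite x μ ν s t, μ, ν, h⟩ : Circle) : ℂ)
      = κ * curl1 A ⟨secSite x μ ν s t, μ, ν, h⟩ := by
    intro s t
    rw [plaq_expField, Circle.coe_exp]
    exact argB_exp_mul_I ⟨(abs_lt.1 (hA s t)).1.le, (abs_lt.1 (hA s t)).2⟩
  simp_rw [hterm, ← Finset.mul_sum]
  rw [sum_curl1_section A x h]
  simp

/-- **NO GAUGE TRANSFORMATION MAKES A NONZERO-FLUX FIELD INTO `exp(iκA)` WITH ALL `|κ(∂A)(p)| < π`** along the section: if `u^g = exp(iκA)`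
then some plaquette of the section has `|κ(∂A)(p)| ≥ π`.  With `κ = e_kη` this says: `A` is not small.
[cite: BalabanImbrieJaffe1985, (2.7) p.303, (7.3.1) p.326] -/
theorem exists_large_circ_of_flux_ne_zero (u : U1Field P j) (x : Balaban1983to89.Site P j) {μ ν : Fin P.d} (h : μ < ν)
    (hflux : fluxU u x μ ν h ≠ 0) (g : Balaban1983to89.Site P j → Circle) (κ : ℝ) (A : PBond P j → ℝ)
    (hgauge : gaugeU g u = expField κ A) :
    ∃ s t : ZMod (P.sitesPerDir j), Real.pi ≤ |κ * curl1 A ⟨secSite x μ ν s t, μ, ν, h⟩| := by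
  by_contra hcon
  push Not at hcon
  apply hflux
  rw [← fluxU_gaugeU g u x h, hgauge]
  exact fluxU_expField_eq_zero κ A x h hcon

/-- **HEADLINE OF THE FILE (C1 carriers).**  At every level with `N_{i+k} ≥ 3`, for every coupling `e ≠ 0`, `ηL^k = 1`, plane `μ₀ < ν₀`
and every `X` with `|e_kη(∂X)(p)| < π/2`: there is a unit-lattice field `v = exp(ie_kB)` satisfying the (7.3.1) shape `|v(∂p′) − 1| ≤
2π/N_{i+k}²` at EVERY plaquette, such that the actual background `u_k = (Q^{s*}_kv)·exp[−ie_kηX]` of (4.5.4) admits NO gauge transformation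
`g` on the whole η-torus `T^{(i)}` and NO `(κ, A)` with `u_k^g = exp(iκA)` and `|κ(∂A)(p)| < π` along any `(μ₀, ν₀)`-coordinate 2-torus —
the print's «in a local region Λ» (p. 326) is necessary. [cite: BalabanImbrieJaffe1985, (4.5.4) p.313, (7.3.1) p.326] -/
theorem exists_background454_no_global_small_gauge (hd : 2 ≤ P.d) {k : ℕ} (hk : i + k ≤ P.m + P.K) (h3 : 3 ≤ P.sitesPerDir (i + k))
    {e : ℝ} (he : e ≠ 0) (η : ℝ) (hη : η * (P.L : ℝ) ^ k = 1) (X : PBond P i → ℝ)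
    (hX : ∀ p : Balaban1983to89.Plaq P i, |e * η * curl1 X p| < Real.pi / 2) {μ₀ ν₀ : Fin P.d} (hμν₀ : μ₀ < ν₀) :
    ∃ B : PBond P (i + k) → ℝ,
      (∀ p' : Balaban1983to89.Plaq P (i + k),
        ‖((plaq (expField e B) p' : Circle) : ℂ) - 1‖ ≤ 2 * Real.pi / ((P.sitesPerDir (i + k) : ℝ) ^ 2)) ∧
      ∀ (g : Balaban1983to89.Site P i → Circle) (κ : ℝ) (A : PBond P i → ℝ),
        gaugeU g (expField (e * η) (fun b => (torusBlockBondsIter P i k).Qsstar B b - X b)) = expField κ A →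
        ∀ x : Balaban1983to89.Site P i,
          ∃ s t : ZMod (P.sitesPerDir i), Real.pi ≤ |κ * curl1 A ⟨secSite x μ₀ ν₀ s t, μ₀, ν₀, hμν₀⟩| := by
  obtain ⟨B, hB, hflux⟩ := exists_flux_one_background454 hd hk h3 he η hη X hX hμν₀
  refine ⟨B, hB, fun g κ A hgauge x => exists_large_circ_of_flux_ne_zero _ x hμν₀ ?_ g κ A hgauge⟩
  rw [hflux x]
  exact one_ne_zero

end NoGlobalGauge

end

end Literature.MathematicalPhysics.QuantumFieldTheory.BalabanImbrieJaffe1984to88.BIJ85FluxSectors731
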